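import Summits.BirchSwinnertonDyer.BirchSwinnertonDyer.Theorems.SchneiderFreeAdditiveX3UpperGordCellOfPartnerLower
import HarnessLib

/-!
# Route `SchneiderFreeAdditiveX3Upper` (K1 wing) on the (G-ord, `e = 2`) cell, PER PAIR: the upper half from the Heegner TWIST'S
# LOWER HALF — the Case-1 hypothesis in its SATISFIABLE form (imaginary quadratic Heegner twists only)

Cell `bsd-schneider-ideate`, seat `bsd-schneider-door-c5` (prover, generation 21; assembly layer; `--supports` 20364).
PARTITION: board row B6 ∩ X3 ∩ sst-twist, `r = 1`, (G-ord, `e = 2`) half (2 560 of 7 101 pairs) of `Rank1Residual.partition`;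
types-the-object-of nothing new; RE-KEYS the wing's r2 input at a pair from a certificate to rung K1's rank-zero Case-1 theorem (item
19363, CLOSED); closes none of B6's cells (BSD NOT advanced).  bears_on: K1-wing (20364 r2, 20365 r3) + K1-door (19177) + K1 (19363).

Companion of `…UpperGordCellOfPartnerLower` (same seat, same generation), whose §2–§3 carry the per-pair Case-1 hypothesis for ALL
rank-0 quadratic twists `W^{(d)}`, `d ∈ ℤ` — correct but idle (see §1's scope note: real and imaginary twists cannot both have Case-1
members on the census).  This file restates them with the hypothesis the proof actually uses: Case-1 members for the rank-0 minimal
models of `W^{(d_K)}`, `K` IMAGINARY quadratic with the Heegner hypothesis for `N_W`.  By the parity flip under `χ_{d_K}` (`d_K < 0`) and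
the invariance of the type at the split prime `p`, this holds exactly when the class of `W` has an ODD rational `p`-line of
multiplicative type: 549 of the 2 560 (G-ord) census pairs (kit j311549: `p = 3`: 468 / 2 411, `5`: 76 / 131, `7`: 4 / 16, `13`: 1 / 2;
`memos/census-door-c5-g21/case1_census_j311549.tsv`).  On those pairs the upper half rests on K1's printed/reading facts and NO
twist-unit certificate; on the other 2 011 (Case 1 themselves, twists in Greenberg–Vatsal's Case 2) wing r2 (TU) stays the input.

HONEST FRAMING: THEOREMS ONLY; pure composition of tree theorems; CONDITIONAL on the displayed hypotheses (Keller–Yin preprint; K1's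
reading facts; the Case-1 condition per class); nothing is closed by me; BSD is proved for no curve; «closes rung: none».
References: [GreenbergVatsal2000] §2 p. 28, Thm. 3.12; [MilneADT2006] Thm. I.7.3; [GrossZagier1986] I.(6.3), (7.3);
[JetchevSkinnerWan2017] §7.4.1; [Miller2011LMS] Def. 1.1; [Delbourgo1998] Prop. 4; [KellerYin2024b] Thm. 3.5.1 (preprint).
-/

set_option autoImplicit false
-- `Summit.<P>.<Sub>` repeats `BirchSwinnertonDyer` by the tree's layout convention (D-0017)
set_option linter.dupNamespace false

noncomputable section

open scoped Classical NumberField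

open Field NumberField IsDedekindDomain WeierstrassCurve
  Literature.NumberTheory.EllipticCurves Literature.NumberTheory.EllipticCurves.GreenbergSelmer
  Literature.NumberTheory.GaloisRepresentations Literature.NumberTheory.GaloisCohomology
  Literature.NumberTheory.EllipticCurves.ModularForms Literature.NumberTheory.EllipticCurves.Rank1Residual
  Literature.NumberTheory.EllipticCurves.Rank1Residual.Typed
  Literature.NumberTheory.EllipticCurves.KellerYin2024 Literature.NumberTheory.EllipticCurves.GreenbergVatsal2000
  Summit.BirchSwinnertonDyer.Rank1Residual Summit.BirchSwinnertonDyer.Rank1Residual.Additive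
  Summit.BirchSwinnertonDyer.Rank1Residual.X11b
  Summit.BirchSwinnertonDyer.BirchSwinnertonDyer.Theorems.SchneiderFree
  Summit.BirchSwinnertonDyer.BirchSwinnertonDyer.Theorems.SchneiderFree.Upper
  Summit.BirchSwinnertonDyer.BirchSwinnertonDyer.Theses.SchneiderFreeAdditiveX3
  Summit.BirchSwinnertonDyer.BirchSwinnertonDyer.Theorems.SchneiderFreeAdditiveX3.ControlDischarged

namespace Summit.BirchSwinnertonDyer.BirchSwinnertonDyer.Theorems.SchneiderFreeAdditiveX3.KYBranchOnly

/-! ### §1 The Case-1 hypothesis restricted to IMAGINARY quadratic HEEGNER twists — the satisfiable form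

CORRECTION OF SCOPE (census kit j311549, memos/FINDING-door-c5-g21.md §1b): `…UpperGordCellOfPartnerLower` §2–§3 ask a Case-1 member for EVERY rank-0 quadratic
twist `W^{(d)}`, `d ∈ ℤ`.  A twist by `d < 0` FLIPS the parity of a rational `p`-line (and keeps its type at `p` when `p` splits), a
twist by `d > 0` KEEPS it; on the census NO class has both an odd and an even multiplicative-type line, so the `∀ d` hypothesis of those
theorems is (in practice) never satisfiable for a class with rank-0 twists of both signs — those theorems are correct but idle.  The proof of §2 there
uses the hypothesis ONLY at the imaginary quadratic Heegner field it chooses; the theorems below carry exactly that: «for every imaginary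
quadratic `K` with the Heegner hypothesis for `N_W`, every globally minimal model of `W^{(d_K)}` of analytic rank `0` has a Case-1 member»
— which HOLDS for the 549 / 2 560 (G-ord) census classes with an odd multiplicative-type `p`-line (and fails for the other 2 011). -/

/-- **UPPER half per pair on the (G-ord, `e = 2`) cell from the PARTNER's LOWER half, Case-1 hypothesis at IMAGINARY HEEGNER twists
only** — `…UpperGordCellOfPartnerLower` §2 VERBATIM with the per-pair hypothesis restricted to the twists the proof uses: for every imaginary quadratic `K` satisfying
the Heegner hypothesis for `N_W`, every globally minimal model `Wd` of `W^{(d_K)}` with `r_an(Wd) = 0` has `HasCaseOneMember Wd p`.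
CONDITIONAL on the displayed hypotheses; closes no item; BSD not advanced. [cite: GreenbergVatsal2000, §2 p. 28]
[cite: GrossZagier1986, Thm. I.(6.3) and (7.3)] [cite: MilneADT2006, Thm. I.7.3] [cite: JetchevSkinnerWan2017, §7.4.1 (arXiv:1512.06894 p. 30)] -/
theorem missingUpperBoundAt_gordTwo_of_partnerLowerHeegner_of_hsieh_of_lzz_of_KY_branch_of_castellaHsieh_signed (hF : PrintedFacts)
    (hA : Hsieh2014.thmA_exists_isHsiehLFunction_unrPeriod_anyLevel)
    (hL : LiuZhangZhang2018.thm151_thm153_modularCurve_heegnerVector_additive)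
    (hKYb : thm351_charIdeal_eq_branch_OPEN) (hCHσ : castellaHsieh2018_exists_isBranchBDPLFunction_signed)
    (hPL : ∀ (Wd : WeierstrassCurve ℚ) [Wd.IsElliptic] [Wd.IsGloballyMinimal] (p : ℕ) [Fact p.Prime],
      Wd.analyticRank = 0 → N10.CellGordTwo Wd p → HasCaseOneMember Wd p → MissingLowerBoundAt Wd p) :
    ∀ (W : WeierstrassCurve ℚ) [W.IsElliptic] [W.IsGloballyMinimal] (p : ℕ) [Fact p.Prime],
      W.analyticRank = 1 → p ≠ 2 → ClassX3 W p → Additive.SubGordTwo W p →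
      (∀ (K : Type) [Field K] [NumberField K], IsImaginaryQuadratic K → SatisfiesHeegnerHypothesis (W.conductorNorm ℤ) K →
        ∀ (Wd : WeierstrassCurve ℚ) [Wd.IsElliptic] [Wd.IsGloballyMinimal],
          (∃ C : VariableChange ℚ, C • W.quadraticTwist (NumberField.discr K : ℚ) = Wd) → Wd.analyticRank = 0 →
          HasCaseOneMember Wd p) →
      MissingUpperBoundAt W p := by
  obtain ⟨hGZ, hKo, hGZK, hmod, hPar, hCas, hGZ73, hFH, hpar, hHP, -, -, -⟩ := id hF
  have hCtl := anticycControlAdditiveKF_proof controlFacts_proof.1 controlFacts_proof.2.1 controlFacts_proof.2.2.1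
    controlFacts_proof.2.2.2 hKo
  have hCoG := gordTwoBranchCoIMCField_of_hsieh_of_lzz_of_KY_branch_of_castellaHsieh_signed hKo hPar hA hL hKYb hCHσ
  intro W _ _ p _ hr hp2 hX hG hC1
  have hpp : p.Prime := Fact.out
  have hS : Additive.SubSemistableTwist W p := Or.inr hG
  obtain ⟨N, _, K, _, _, Dt, H, ι, P, Wd, _, _, hN, hK, hodd, hunit, hHe, hLtw, hP, hnt, hWd, hrd, hXd, hSd, h8⟩ :=
    exists_heegnerTwistDataManin_discr_emod_eight hFH hpar hHP hGZ hmod W p hr hp2 hX hS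
  obtain ⟨Cd, hCd⟩ := hWd
  have hdK : NumberField.discr K ≠ -3 := discr_ne_neg_three_of_emod_eight h8
  have hD0 : (NumberField.discr K : ℚ) ≠ 0 := by exact_mod_cast NumberField.discr_ne_zero K
  have hpN : p ∣ W.conductorNorm ℤ := (W.dvd_conductorNorm_iff_not_hasGoodReductionAtPrime p).mpr hX.2.1
  have hHH : SatisfiesHeegnerHypothesis (W.conductorNorm ℤ) K := by rw [hN]; exact hHe
  obtain ⟨hpd, hw⟩ := X11b.Three.not_dvd_discr_and_not_dvd_torsionOrder_of_heegner hK hHH hp2 hpN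
  obtain ⟨W₁, _, _, h1, hN1, hLoc1, htf1, hco1⟩ :=
    Upper.coChainMemberField_gordTwo_of_coIMCField_of_control hKo hPar hCtl hCoG W p hr hp2 hX hG K hK hpd hdK
  haveI := W.isElliptic_quadraticTwist hD0
  haveI := W₁.isElliptic_quadraticTwist hD0
  have hr1 : W₁.analyticRank = 1 := by rw [← analyticRank_eq_of_isIsogenous' h1]; exact hr
  have hHH1 : SatisfiesHeegnerHypothesis (W₁.conductorNorm ℤ) K := by rw [hN1]; exact hHH
  have hpN1 : p ∣ W₁.conductorNorm ℤ := by rw [hN1]; exact hpN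
  have hLd1 : (W₁.quadraticTwist (NumberField.discr K : ℚ)).entireLFunction 1 ≠ 0 := by
    rw [← entireLFunction_eq_of_isIsogenous' (h1.quadraticTwist hD0)]; exact hLtw
  haveI hN0 : NeZero (W₁.conductorNorm ℤ) := ⟨W₁.conductorNorm_pos_holds.ne'⟩
  obtain ⟨Dt₁, H₁, ι₁, P₁, hP₁, hnt₁⟩ :=
    exists_heegnerPoint_not_isOfFinAddOrder_of_twist_ne_zero hHP hGZ hmod W₁ (W₁.conductorNorm ℤ) K hr1 rfl hK hHH1 hLd1
  have hI : IndexUpperBoundLeAt W₁ p K P₁ (padicValNat p Dt₁.c.natAbs) :=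
    hco1 (W₁.conductorNorm ℤ) Dt₁ H₁ ι₁ P₁ hr1 hLoc1 rfl hK hodd hw hHH1 hLd1 hP₁ hnt₁ htf1
  obtain ⟨C₁, hC₁⟩ := hasGlobalMinimalModel_rat_holds (W₁.quadraticTwist (NumberField.discr K : ℚ))
  set W₁d : WeierstrassCurve ℚ := C₁ • W₁.quadraticTwist (NumberField.discr K : ℚ) with hW₁d_def
  haveI : W₁d.IsGloballyMinimal := hC₁
  have hW₁d : C₁ • W₁.quadraticTwist (NumberField.discr K : ℚ) = W₁d := rfl
  have hJ1 : JointUpperBoundAt W₁ W₁d p :=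
    jointUpperBoundAt_of_coStepL_manin hGZ hKo hGZK hmod hGZ73 W₁ p (W₁.conductorNorm ℤ) K Dt₁ H₁ ι₁ P₁ W₁d hr1 rfl hpN1 hK
      hodd hw hHH1 hLd1 hP₁ ⟨C₁, hW₁d⟩ hp2 hI
  have h1W : IsIsogenous W₁ W := h1.symm_of_isElliptic
  have h1d : IsIsogenous W₁d Wd := by
    rw [← hW₁d, ← hCd]
    exact IsIsogenous.trans' (IsIsogenous.trans' (isIsogenous_of_smul _ C₁) (h1W.quadraticTwist hD0)) (isIsogenous_smul _ Cd)
  have hrd1 : W₁d.analyticRank ≤ 1 := by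
    have h0 : (W₁.quadraticTwist (NumberField.discr K : ℚ)).analyticRank = 0 :=
      ((W₁.quadraticTwist _).analyticRank_eq_zero_iff_holds (hmod _)).2 hLd1
    rw [← hW₁d, analyticRank_smul, h0]; exact zero_le_one
  have hJ : JointUpperBoundAt W Wd p := jointUpperBoundAt_of_isIsogenous hCas hGZK hmod h1W h1d hr1.le hrd1 hJ1
  have hcell : N10.CellGordTwo Wd p := cellGordTwo_twist_of_heegner p W hp2 K hK hodd hHH hX Cd hCd hG
  exact Upper.missingUpperBoundAt_of_jointUpper_of_lower hJ (hPL Wd p hrd hcell (hC1 K hK hHH Wd ⟨Cd, hCd⟩ hrd))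

/-- **BOTH halves per pair on the (G-ord, `e = 2`) cell from the partner's lower half, Case-1 hypothesis at imaginary Heegner twists
only** (the door's per-pair lower half + the previous theorem). CONDITIONAL; closes no item; BSD not advanced.
[cite: Miller2011LMS, Def. 1.1] [cite: KellerYin2024b, Thm. 3.5.1 (arXiv:2410.23241 p. 20) (preprint; hypotheses)] -/
theorem missingPPartAt_gordTwo_of_partnerLowerHeegner_of_hsieh_of_lzz_of_KY_branch_of_castellaHsieh_signed (hF : PrintedFacts)
    (hA : Hsieh2014.thmA_exists_isHsiehLFunction_unrPeriod_anyLevel)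
    (hL : LiuZhangZhang2018.thm151_thm153_modularCurve_heegnerVector_additive)
    (hKYb : thm351_charIdeal_eq_branch_OPEN) (hKYμ : thm351_mu_zero_branch_OPEN)
    (hCHσ : castellaHsieh2018_exists_isBranchBDPLFunction_signed)
    (hPL : ∀ (Wd : WeierstrassCurve ℚ) [Wd.IsElliptic] [Wd.IsGloballyMinimal] (p : ℕ) [Fact p.Prime],
      Wd.analyticRank = 0 → N10.CellGordTwo Wd p → HasCaseOneMember Wd p → MissingLowerBoundAt Wd p) :
    ∀ (W : WeierstrassCurve ℚ) [W.IsElliptic] [W.IsGloballyMinimal] (p : ℕ) [Fact p.Prime],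
      W.analyticRank = 1 → p ≠ 2 → ClassX3 W p → Additive.SubGordTwo W p →
      (∀ (K : Type) [Field K] [NumberField K], IsImaginaryQuadratic K → SatisfiesHeegnerHypothesis (W.conductorNorm ℤ) K →
        ∀ (Wd : WeierstrassCurve ℚ) [Wd.IsElliptic] [Wd.IsGloballyMinimal],
          (∃ C : VariableChange ℚ, C • W.quadraticTwist (NumberField.discr K : ℚ) = Wd) → Wd.analyticRank = 0 →
          HasCaseOneMember Wd p) →
      MissingPPartAt W p :=
  fun W _ _ p _ hr hp2 hX hG hC1 =>
    missingPPartAt_of_lower_of_upper W p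
      (missingLowerBoundAt_gordTwo_of_printedFacts_of_hsieh_of_lzz_of_KY_branch_of_castellaHsieh_signed hF hA hL hKYb hKYμ hCHσ W p
        hr hp2 hX hG)
      (missingUpperBoundAt_gordTwo_of_partnerLowerHeegner_of_hsieh_of_lzz_of_KY_branch_of_castellaHsieh_signed hF hA hL hKYb hCHσ hPL
        W p hr hp2 hX hG hC1)

/-- **`MissingPPartAt` per pair on the (G-ord, `e = 2`) cell with rung K1's Case-1 theorem (item 19363) as the wing's r2 input,
Case-1 hypothesis at imaginary Heegner twists only** — `hPL` := `AdditiveBranchIMCInputs.x3CaseOneRankZero_of_facts`.  Available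
on the 549 / 2 560 census classes with an odd multiplicative-type `p`-line (kit j311549).  CONDITIONAL; closes no item; BSD not advanced.
[cite: GreenbergVatsal2000, Thm 3.12] [cite: Delbourgo1998, Prop 4] [cite: MilneADT2006, Thm I.7.3] -/
theorem missingPPartAt_gordTwo_of_K1factsHeegner_of_hsieh_of_lzz_of_KY_branch_of_castellaHsieh_signed (hF : PrintedFacts)
    (hA : Hsieh2014.thmA_exists_isHsiehLFunction_unrPeriod_anyLevel)
    (hL : LiuZhangZhang2018.thm151_thm153_modularCurve_heegnerVector_additive)
    (hKYb : thm351_charIdeal_eq_branch_OPEN) (hKYμ : thm351_mu_zero_branch_OPEN)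
    (hCHσ : castellaHsieh2018_exists_isBranchBDPLFunction_signed)
    (h23 : datumSelmer_nonPrimitive_invariants)
    (h414 : Greenberg1999.prop414_noFiniteSubmodule_of_not_dvd_torsionOrder)
    (hGrK : Greenberg1999.imKummer_ge_strictCondition_goodOrdinary)
    (hDel98 : Delbourgo1998.prop4_rankZero_pow_dvd_constantCoeff)
    (hW16 : Wuthrich2014.thm16_halfEigenCharIdeal_dvd_cyclotomicPrime)
    (hGV : thm312_branch_unitContent_and_lambda_eq_residual_goodOrd)
    (hLiftF : residualEpsilon_surjOn_of_lineRamifiedEven) (hLiftE : residualEpsilon_surjOn_of_lineEven)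
    (hDelG : Delbourgo1998.prop4_rankZero_constantCoeff_eq_unit_mul_of_potGoodOrd) :
    ∀ (W : WeierstrassCurve ℚ) [W.IsElliptic] [W.IsGloballyMinimal] (p : ℕ) [Fact p.Prime],
      W.analyticRank = 1 → p ≠ 2 → ClassX3 W p → Additive.SubGordTwo W p →
      (∀ (K : Type) [Field K] [NumberField K], IsImaginaryQuadratic K → SatisfiesHeegnerHypothesis (W.conductorNorm ℤ) K →
        ∀ (Wd : WeierstrassCurve ℚ) [Wd.IsElliptic] [Wd.IsGloballyMinimal],
          (∃ C : VariableChange ℚ, C • W.quadraticTwist (NumberField.discr K : ℚ) = Wd) → Wd.analyticRank = 0 →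
          HasCaseOneMember Wd p) →
      MissingPPartAt W p := by
  obtain ⟨-, -, hGZK, hmod, hmodD, hCas, -⟩ := id hF
  exact missingPPartAt_gordTwo_of_partnerLowerHeegner_of_hsieh_of_lzz_of_KY_branch_of_castellaHsieh_signed hF hA hL hKYb hKYμ hCHσ
    (AdditiveBranchIMCInputs.x3CaseOneRankZero_of_facts h23 h414 hGrK hDel98 hGZK hmod hmodD hCas hW16 hGV hLiftF hLiftE hDelG)

/-- **Miller's `BSD(E, p)` per pair on the (G-ord, `e = 2`) cell with K1's Case-1 theorem, Case-1 hypothesis at imaginary Heegner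
twists only** (`bsdp_of_missingPPartAt`; GZK).  NOT a proof of BSD for any curve. [cite: Miller2011LMS, §1 and Def. 1.1]
[cite: GreenbergVatsal2000, Thm 3.12] -/
theorem bsdp_gordTwo_of_K1factsHeegner_of_hsieh_of_lzz_of_KY_branch_of_castellaHsieh_signed (hF : PrintedFacts)
    (hA : Hsieh2014.thmA_exists_isHsiehLFunction_unrPeriod_anyLevel)
    (hL : LiuZhangZhang2018.thm151_thm153_modularCurve_heegnerVector_additive)
    (hKYb : thm351_charIdeal_eq_branch_OPEN) (hKYμ : thm351_mu_zero_branch_OPEN)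
    (hCHσ : castellaHsieh2018_exists_isBranchBDPLFunction_signed)
    (h23 : datumSelmer_nonPrimitive_invariants)
    (h414 : Greenberg1999.prop414_noFiniteSubmodule_of_not_dvd_torsionOrder)
    (hGrK : Greenberg1999.imKummer_ge_strictCondition_goodOrdinary)
    (hDel98 : Delbourgo1998.prop4_rankZero_pow_dvd_constantCoeff)
    (hW16 : Wuthrich2014.thm16_halfEigenCharIdeal_dvd_cyclotomicPrime)
    (hGV : thm312_branch_unitContent_and_lambda_eq_residual_goodOrd)
    (hLiftF : residualEpsilon_surjOn_of_lineRamifiedEven) (hLiftE : residualEpsilon_surjOn_of_lineEven)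
    (hDelG : Delbourgo1998.prop4_rankZero_constantCoeff_eq_unit_mul_of_potGoodOrd) :
    ∀ (W : WeierstrassCurve ℚ) [W.IsElliptic] [W.IsGloballyMinimal] (p : ℕ) [Fact p.Prime],
      W.analyticRank = 1 → p ≠ 2 → ClassX3 W p → Additive.SubGordTwo W p →
      (∀ (K : Type) [Field K] [NumberField K], IsImaginaryQuadratic K → SatisfiesHeegnerHypothesis (W.conductorNorm ℤ) K →
        ∀ (Wd : WeierstrassCurve ℚ) [Wd.IsElliptic] [Wd.IsGloballyMinimal],
          (∃ C : VariableChange ℚ, C • W.quadraticTwist (NumberField.discr K : ℚ) = Wd) → Wd.analyticRank = 0 →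
          HasCaseOneMember Wd p) →
      BSDp W p :=
  fun W _ _ p _ hr hp2 hX hG hC1 =>
    bsdp_of_missingPPartAt W p hF.2.2.1 (le_of_eq hr)
      (missingPPartAt_gordTwo_of_K1factsHeegner_of_hsieh_of_lzz_of_KY_branch_of_castellaHsieh_signed hF hA hL hKYb hKYμ hCHσ h23 h414
        hGrK hDel98 hW16 hGV hLiftF hLiftE hDelG W p hr hp2 hX hG hC1)

end Summit.BirchSwinnertonDyer.BirchSwinnertonDyer.Theorems.SchneiderFreeAdditiveX3.KYBranchOnly

end
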